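import Summits.BirchSwinnertonDyer.BirchSwinnertonDyer.Theorems.PrintX11aNonSurjEulerHalfBranchesDefs
import Literature.NumberTheory.EllipticCurves.GreenbergSelmer
import Literature.NumberTheory.EllipticCurves.PAdicLFunction
import Literature.NumberTheory.EllipticCurves.Wuthrich2014.IntegralPAdicLFunctionMultiplicative
import HarnessLib

/-!
# Route `PrintX11a` (cell `bsd-print-x11a`), children U5 `UpperNonSurjFive` (item stmt-BirchSwinnertonDyer-20614) and
# U3 `UpperNonSurjThree` (item stmt-BirchSwinnertonDyer-20613) of crux 3 `X11aNonSurjEulerHalf`: the HARD-LOCUS analytic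
# `μ`-certificates — the objects the planner's registered «hardlocus» lines posit, as Theses-free `Prop` constants
# (`--supports stmt-BirchSwinnertonDyer-20614 --as helper`; planner g3 draft + g4 cite fix N30-2, to be proposed VERBATIM by a prover/typist seat)

The registered skeleton of each child (planner g3, 2026-08-27, `ledger skeleton check` OK) has two stubs: the published
inputs `Theses.ErratumRoadFive.KatoTwinFactsFiveAn` (K2's item 19949 BY NAME) and the analytic `μ`-certificate below,
demanded ONLY on the hard sub-locus {`p` split multiplicative} ∪ {`L(E,1)/Ω_E` not a `p`-adic unit}. On the
complementary non-split unit-value sub-locus the Euler half is closed modulo the displayed facts by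
`Theorems.x11a_missingUpperBoundAt_of_not_surj_of_nonsplit_of_unit_value` (file `PrintX11aNonSurjEulerHalfOfMu.lean`),
so the restriction loses nothing and names exactly where the open content lives. These constants are the RESTRICTIONS of
`Theorems.X11aNonSurjMuAn` / `X11aNonSurjMuAnAtThree` (file `PrintX11aNonSurjEulerHalfBranchesDefs.lean`) to that
sub-locus and to the prime regime of the child; same currency (`IsMultPAdicLFunctionOf`, `plusPeriod`, `IsNewformOf`).
Per pair each is a finite exact modular-symbol computation (p3 g1 kit j284126: a unit Teichmüller-coset coefficient at
level `n ∈ {2,3}` for all 22 hard pairs with `N < 10⁵`; kit j284583: 10/15 more at `p = 5`, `N ≥ 10⁵`, so far).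
Definitions only; nothing asserted; no `sorry`; no new Literature fact.
[cite: GreenbergLNM1716, §1 Conj. 1.11 (p. 61) (shape only; nothing asserted)]
[cite: Wuthrich2014, Cor. 18 (p. 398) (ϖ·L_p(E) ∈ Λ at a multiplicative odd prime)]
[cite: MazurTateTeitelbaum1986, §I.10, §I.12 (p. 16) and §II.10 (p. 37) (α = a_p is the unique allowable p-root at p ∥ N)]
-/

set_option linter.dupNamespace false
set_option autoImplicit false

noncomputable section

open scoped Classical NumberField MatrixGroups ModularForm

open CongruenceSubgroup WeierstrassCurve Field
  Literature.NumberTheory.EllipticCurves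
  Literature.NumberTheory.EllipticCurves.ModularForms
  Literature.NumberTheory.EllipticCurves.Rank1Residual
  Summit.BirchSwinnertonDyer.Rank1Residual

namespace Summit.BirchSwinnertonDyer.BirchSwinnertonDyer.Theorems

/-- [registered stub `stub_muAnHardFive` of item 20614 `UpperNonSurjFive`, line «hardlocus5»] **analytic `μ = 0` on the
HARD sub-locus of the non-surjective X11a pairs with `5 ≤ p`.** For every globally minimal `W` in class X11a with
`ρ̄_{W,p}` NOT onto and `5 ≤ p`, lying on the hard sub-locus (`p` split multiplicative, or `L(W,1)/Ω_W` of non-zero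
`p`-adic valuation), every newform `f` of `W`, period ratio `ϖ` (`ϖ·Ω_W = Ω⁺_f`) and every Mazur–Tate–Teitelbaum function
`L` of `f` at `p` with allowable root `a` (`a = 1` split, `a = −1` non-split): SOME coefficient of `ϖ·L` is a `p`-adic
unit. Restriction of `X11aNonSurjMuAn`; class-wide = Greenberg's Conj. 1.11 on a thin explicit family (OPEN); per pair a
finite certificate. A `Prop` constant; nothing asserted. [cite: GreenbergLNM1716, §1 Conj. 1.11 (p. 61) (shape only)]
[cite: Wuthrich2014, Cor. 18 (p. 398)] -/
@[conjecture]
def X11aNonSurjMuAnHardFive : Prop :=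
  ∀ (W : WeierstrassCurve ℚ) [W.IsElliptic] [W.IsGloballyMinimal] (p : ℕ) [Fact p.Prime],
    ClassX11a W p → ¬ Surj W p → 5 ≤ p →
    (W.HasSplitMultiplicativeReductionAtPrime p ∨
      ∀ t : ℚ, W.entireLFunction 1 / (W.realPeriodRat : ℂ) = (t : ℂ) → padicValRat p t ≠ 0) →
    ∀ {N : ℕ} [NeZero N] (f : CuspForm (Gamma0 N) 2), IsNewformOf W f →
      ∀ (ϖ : ℚ), (ϖ : ℝ) * W.realPeriodRat = plusPeriod f →
      ∀ (a : ℚ_[p]) (L : PowerSeries ℚ_[p]),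
        (W.HasSplitMultiplicativeReductionAtPrime p → a = 1) →
        (¬ W.HasSplitMultiplicativeReductionAtPrime p → a = -1) →
        IsMultPAdicLFunctionOf f p a L →
        ∃ n : ℕ, ‖PowerSeries.coeff n (PowerSeries.C ((ϖ : ℚ) : ℚ_[p]) * L)‖ = 1

/-- [registered stub `stub_muAnHardThree` of item 20613 `UpperNonSurjThree`, line «hardlocus3»] **analytic `μ = 0` on
the HARD sub-locus of the non-surjective X11a pairs with `p = 3`** (images `3Ns/3Nn`): as `X11aNonSurjMuAnHardFive`
with `p = 3`; restriction of `X11aNonSurjMuAnAtThree`. A `Prop` constant; nothing asserted.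
[cite: GreenbergLNM1716, §1 Conj. 1.11 (p. 61) (shape only)] [cite: Wuthrich2014, Cor. 18 (p. 398)] -/
@[conjecture]
def X11aNonSurjMuAnHardThree : Prop :=
  ∀ (W : WeierstrassCurve ℚ) [W.IsElliptic] [W.IsGloballyMinimal] (p : ℕ) [Fact p.Prime],
    ClassX11a W p → ¬ Surj W p → p = 3 →
    (W.HasSplitMultiplicativeReductionAtPrime p ∨
      ∀ t : ℚ, W.entireLFunction 1 / (W.realPeriodRat : ℂ) = (t : ℂ) → padicValRat p t ≠ 0) →
    ∀ {N : ℕ} [NeZero N] (f : CuspForm (Gamma0 N) 2), IsNewformOf W f →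
      ∀ (ϖ : ℚ), (ϖ : ℝ) * W.realPeriodRat = plusPeriod f →
      ∀ (a : ℚ_[p]) (L : PowerSeries ℚ_[p]),
        (W.HasSplitMultiplicativeReductionAtPrime p → a = 1) →
        (¬ W.HasSplitMultiplicativeReductionAtPrime p → a = -1) →
        IsMultPAdicLFunctionOf f p a L →
        ∃ n : ℕ, ‖PowerSeries.coeff n (PowerSeries.C ((ϖ : ℚ) : ℚ_[p]) * L)‖ = 1

/-- The hard-locus certificate at `5 ≤ p` is implied by the class-wide analytic certificate `X11aNonSurjMuAn`
(drop the locus hypothesis). [cite: GreenbergLNM1716, §1 Conj. 1.11 (p. 61) (shape only)] -/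
theorem x11aNonSurjMuAnHardFive_of_muAn (h : X11aNonSurjMuAn) : X11aNonSurjMuAnHardFive :=
  fun W _ _ p _ hX hns _ _ _N _ f hf ϖ hϖ a L hs hn hL => h W p hX hns f hf ϖ hϖ a L hs hn hL

/-- The hard-locus certificate at `p = 3` is implied by `X11aNonSurjMuAnAtThree`.
[cite: GreenbergLNM1716, §1 Conj. 1.11 (p. 61) (shape only)] -/
theorem x11aNonSurjMuAnHardThree_of_muAnAtThree (h : X11aNonSurjMuAnAtThree) : X11aNonSurjMuAnHardThree :=
  fun W _ _ p _ hX hns hp _ _N _ f hf ϖ hϖ a L hs hn hL => h W p hX hns hp f hf ϖ hϖ a L hs hn hL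

end Summit.BirchSwinnertonDyer.BirchSwinnertonDyer.Theorems

end
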